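import Literature.NumberTheory.Automorphic.UnboundedDenominatorsFieldsProofs
import Literature.NumberTheory.Automorphic.UnboundedDenominatorsIharaEnhancedProofs
import HarnessLib

/-!
# The unbounded denominators theorem (Calegari–Dimitrov–Tang) — §4.3: `f(pτ) ∈ R_{Np}` and the dichotomy of Theorem 4.3.2

PROOF-ONLY sequel (no definition, no named fact; D-0026) of
`UnboundedDenominatorsFields.lean` / `UnboundedDenominatorsFieldsProofs.lean` (CDT's fields
`M_N = levelField N ⊆ R_N = bddDenField N` inside `Mer = Frac 𝓗`) and of the group theory of §4
(`UnboundedDenominatorsIharaEnhancedProofs.lean`: Theorem 4.3.1 from the two hypothesis-form inputs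
`hker₂` (amalgam + congruence subgroup property of `SL₂(ℤ[1/p])`) and `hcor` (Corollary 4.5.3)).
Source: F. Calegari, V. Dimitrov, Y. Tang, *The unbounded denominators conjecture*, J. Amer. Math.
Soc. **38** (2025), 627–702 = arXiv:2109.09040, §4.3 (published numbering; arXiv v1 §4.3 with
`f(τ/p)`):

> "if `f(τ) ∈ ℤ⟦q^{1/N}⟧ ∈ R_N`, then `f(pτ) ∈ ℤ⟦q^{1/Np}⟧` is also a modular form with integer
> coefficients … invariant under `A⁻¹ G A ∩ SL₂(ℤ)` … hence `f(pτ) ∈ R_{Np}`. …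
> `[R_{Np} : M_{Np}]/[R_N : M_N] = [R_{Np} : R_N M_{Np}]` is an integer, and it is either `≥ 2`, in
> which case we have proven Theorem 4.3.2, or `R_{Np} = R_N M_{Np}`. … in particular `f(pτ)` is
> invariant under the group `⟨E, G ∩ Γ(Np)⟩` … Theorem 4.3.1 [then says] `f(τ)` is invariant under a
> congruence subgroup."

## What is proved

* §1 `Γ₀(p)`-type bookkeeping: `x ∈ A⁻¹ SL₂(ℤ) A ∩ SL₂(ℤ)` as soon as `p ∣ x₁₀`
  (`mem_conjGL_top_of_dvd`), in particular for `x ∈ Γ(Np)`.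
* §2 Bundling: a weight-`12m` form `F` whose `F/Δᵐ` is fixed by a finite-index `Γ'` IS a modular
  form on `Γ'` (`exists_modularForm_of_forall_smul_modFun_eq`).
* §3 **`f(pτ) ∈ R_{Np}`** [CDT §4.3 ¶1] in the field `Mer`: for a generator `u = F/Δᵐ` of `R_N`
  (`F` on `G` with all conjugates of `Tᴺ`, `F ∈ ℤ⟦q_N⟧`) the dilate `u(pτ) = F(pτ)/Δ(pτ)ᵐ` is the
  quotient of the two generators `F(pτ)/Δᵐ` (on `A⁻¹GA ∩ SL₂(ℤ)`, tree
  `exists_modularForm_conjGL_of_forall_coeff_int`) and `Δ(pτ)ᵐ/Δᵐ` (on `A⁻¹SL₂(ℤ)A ∩ SL₂(ℤ)`) of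
  `R_{Np}` (`exists_dilate`), so it lies in the FIELD `R_{Np}` (`dilate_mem_bddDenField`).
* §4 Invariance transfer: if the dilate is fixed by `γ ∈ Γ(Np)` then `(F ∣ A) ∣ γ = F ∣ A`
  (`slash_slash_eq_of_smul_dilate_eq`).
* §5 ★ **The dichotomy of Theorem 4.3.2** (`bddDenGens_subset_levelGens_of_le_sup`,
  `bddDenField_eq_levelField_of_le_sup`): granted `hker₂` and `hcor` at `(N, p)` (`p ∤ N` prime) and
  finite generation of `R_N`: **if `R_{Np} ⊆ M_{Np} · R_N` then `R_N = M_N`.** (Every generator `u` of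
  `R_N` has its dilate in `R_{Np} = M_{Np} R_N`, which is fixed by `G_N ∩ Γ(Np)`; by §4 and Theorem
  4.3.1 `u` is congruence, hence `Γ(N)`-invariant by Wohlfahrt, hence a generator of `M_N`.) The
  contrapositive is CDT's "`[R_{Np} : R_N M_{Np}] ≥ 2` unless `R_N = M_N`" without the degree count;
  the count (`[R_{Np} : M_{Np}] ≥ 2 [R_N : M_N]`, via `M_{Np} ∩ R_N = M_N` and Galois theory) is left to
  the degree instalment.

## References

* [CalegariDimitrovTang2025] F. Calegari, V. Dimitrov, Y. Tang, The unbounded denominators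
  conjecture, J. Amer. Math. Soc. 38 (2025), no. 3, 627–702; arXiv:2109.09040. §4.3 (first
  paragraph, Theorems 4.3.1 and 4.3.2).
-/

noncomputable section

namespace Literature.NumberTheory.Automorphic

open scoped MatrixGroups ModularForm Manifold
open UpperHalfPlane CongruenceSubgroup Matrix.SpecialLinearGroup ModularGroup

namespace UnboundedDenominators

variable {p : ℕ} {A : GL (Fin 2) ℝ}

/-! ### §1. `Γ₀(p)`-type elements lie in `A⁻¹ SL₂(ℤ) A` -/

/-- The `GL₂(ℝ)` bookkeeping for `A = diag(p, 1)`: `A y = x A` as soon as `y₀₀ = x₀₀`,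
`p y₀₁ = x₀₁`, `y₁₀ = p x₁₀`, `y₁₁ = x₁₁`. [folklore] -/
private lemma diag_mul_mapGL_eq₃ {y x : SL(2, ℤ)}
    (hA : (A : Matrix (Fin 2) (Fin 2) ℝ) = !![(p : ℝ), 0; 0, 1])
    (h00 : y 0 0 = x 0 0) (h01 : (p : ℤ) * y 0 1 = x 0 1) (h10 : y 1 0 = p * x 1 0)
    (h11 : y 1 1 = x 1 1) :
    A * mapGL ℝ y = mapGL ℝ x * A := by
  have r00 : ((y 0 0 : ℤ) : ℝ) = x 0 0 := by exact_mod_cast h00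
  have r01 : (p : ℝ) * y 0 1 = x 0 1 := by exact_mod_cast h01
  have r10 : ((y 1 0 : ℤ) : ℝ) = p * x 1 0 := by exact_mod_cast h10
  have r11 : ((y 1 1 : ℤ) : ℝ) = x 1 1 := by exact_mod_cast h11
  apply Units.ext
  simp only [Units.val_mul, mapGL, MonoidHom.coe_comp, Function.comp_apply, coe_GL_coe_matrix,
    map_apply_coe, RingHom.mapMatrix_apply, hA]
  ext i j
  fin_cases i <;> fin_cases j <;>
    simp only [Matrix.mul_apply, Fin.sum_univ_two, Matrix.map_apply, Matrix.of_apply,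
      Matrix.cons_val', Matrix.cons_val_zero, Matrix.cons_val_one, Matrix.cons_val_fin_one,
      Matrix.empty_val', eq_intCast, Fin.zero_eta, Fin.mk_one, Fin.isValue]
  · linear_combination (p : ℝ) * r00
  · linear_combination r01
  · linear_combination r10
  · linear_combination r11

/-- **`Γ₀(p) ⊆ A⁻¹ SL₂(ℤ) A`**: an `x ∈ SL(2, ℤ)` with `p ∣ x₁₀` lies in `conjGL ⊤ A` for `A`
with matrix `diag(p, 1)` (`A x A⁻¹ = [x₀₀, p x₀₁; x₁₀/p, x₁₁]` is integral) — so `Δ(pτ)` and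
`f(pτ)` transform like modular forms under such `x` ("There is an identification
`A Γ₀(p) A⁻¹ = Γ⁰(p)` inside `SL₂(ℤ)`"). [cite: CalegariDimitrovTang2025, §4.3] -/
theorem mem_conjGL_top_of_dvd (hA : (A : Matrix (Fin 2) (Fin 2) ℝ) = !![(p : ℝ), 0; 0, 1])
    {x : SL(2, ℤ)} (hx : (p : ℤ) ∣ x 1 0) :
    x ∈ conjGL (⊤ : Subgroup SL(2, ℤ)) A := by
  obtain ⟨c, hc⟩ := hx
  have hdet : x 0 0 * x 1 1 - ((p : ℤ) * x 0 1) * c = 1 := by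
    have h := Matrix.SpecialLinearGroup.det_coe x
    rw [Matrix.det_fin_two, hc] at h
    linear_combination h
  let y : SL(2, ℤ) := ⟨!![x 0 0, (p : ℤ) * x 0 1; c, x 1 1], by
    rw [Matrix.det_fin_two_of]; linear_combination hdet⟩
  refine mem_conjGL.mpr ⟨y, Subgroup.mem_top _, ?_⟩
  have h : A * mapGL ℝ x = mapGL ℝ y * A :=
    diag_mul_mapGL_eq₃ (y := x) (x := y) hA (by simp [y]) (by simp [y])
      (by simp [y, hc]) (by simp [y])
  rw [eq_mul_inv_iff_mul_eq]
  exact h.symm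

/-- Elements of `Γ(M)` with `p ∣ M` lie in `A⁻¹ SL₂(ℤ) A ∩ SL₂(ℤ)`.
[cite: CalegariDimitrovTang2025, §4.3] -/
theorem mem_conjGL_top_of_mem_Gamma (hA : (A : Matrix (Fin 2) (Fin 2) ℝ) = !![(p : ℝ), 0; 0, 1])
    {M : ℕ} (hM : p ∣ M) {x : SL(2, ℤ)} (hx : x ∈ Gamma M) :
    x ∈ conjGL (⊤ : Subgroup SL(2, ℤ)) A := by
  refine mem_conjGL_top_of_dvd hA ?_
  obtain ⟨-, -, h10, -⟩ := Gamma_mem.mp hx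
  exact (Int.natCast_dvd_natCast.mpr hM).trans ((ZMod.intCast_zmod_eq_zero_iff_dvd _ M).mp h10)

/-! ### §2. Bundling a form on a group fixing `F/Δᵐ` -/

/-- **A weight-`12m` form whose `F/Δᵐ` is fixed by a finite-index `Γ'` is a modular form on `Γ'`**
(with the same function): slash-invariance is `slash_eq_of_forall_smul_modFun_eq`, holomorphy is
that of `F`, and the cusps of `Γ'` are those of the (arithmetic) level of `F`.
[cite: CalegariDimitrovTang2025, §4.3 (proof of Theorem 4.3.2: "forms in `R_N` are all invariant
by a subgroup `G = G_N`")] -/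
theorem exists_modularForm_of_forall_smul_modFun_eq {G Γ' : Subgroup SL(2, ℤ)} [G.FiniteIndex]
    [Γ'.FiniteIndex] {m : ℕ} (F : ModularForm (G : Subgroup (GL (Fin 2) ℝ)) (12 * (m : ℤ)))
    (h : ∀ γ ∈ Γ', γ • modFun m F = modFun m F) :
    ∃ F' : ModularForm (Γ' : Subgroup (GL (Fin 2) ℝ)) (12 * (m : ℤ)), (F' : ℍ → ℂ) = F :=
  ⟨{ toFun := F
     slash_action_eq' := by
       rintro _ ⟨γ, hγ, rfl⟩
       exact slash_eq_of_forall_smul_modFun_eq F h hγ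
     holo' := F.holo'
     bdd_at_cusps' := fun hc ↦ F.bdd_at_cusps'
       ((Subgroup.IsArithmetic.isCusp_iff_isCusp_SL2Z _).mpr
         ((Subgroup.IsArithmetic.isCusp_iff_isCusp_SL2Z _).mp hc)) }, rfl⟩

/-! ### §3. The dilate `u(pτ)` of a generator of `R_N` lies in `R_{Np}` -/

/-- Powers of `Δ` as modular forms of level `SL(2, ℤ)` with integral `q`-expansion at any positive
integer period. [folklore] -/
private theorem exists_discriminant_pow (m : ℕ) {h : ℕ} (hh : h ≠ 0) :
    ∃ D : ModularForm (((⊤ : Subgroup SL(2, ℤ)) : Subgroup (GL (Fin 2) ℝ))) (12 * (m : ℤ)),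
      (∀ τ, D τ = ModularForm.discriminant τ ^ m) ∧
      ∀ n : ℕ, ∃ z : ℤ, PowerSeries.coeff n (qExpansion (h : ℝ) D) = (z : ℂ) := by
  have hΓ : (((⊤ : Subgroup SL(2, ℤ)) : Subgroup (GL (Fin 2) ℝ))) = 𝒮ℒ :=
    (MonoidHom.range_eq_map (mapGL ℝ : SL(2, ℤ) →* GL (Fin 2) ℝ)).symm
  let Δ₁ : ModularForm (((⊤ : Subgroup SL(2, ℤ)) : Subgroup (GL (Fin 2) ℝ))) 12 :=
    (CuspForm.discriminant : ModularForm 𝒮ℒ 12).mcast rfl hΓ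
  have hΔ₁ : (Δ₁ : ℍ → ℂ) = ModularForm.discriminant := rfl
  refine ⟨(Δ₁.pow m).mcast (by ring), fun τ ↦ ?_, ?_⟩
  · rw [ModularForm.coe_mcast, ModularForm.coe_pow, hΔ₁, Pi.pow_apply]
  · -- integrality: by induction on `m` from that of `Δ`
    have hper : ((h : ℕ) : ℝ) ∈
        (((⊤ : Subgroup SL(2, ℤ)) : Subgroup (GL (Fin 2) ℝ))).strictPeriods :=
      mem_strictPeriods_of_T_pow_mem (Subgroup.mem_top _)
    have hΔint : ∀ n : ℕ, ∃ z : ℤ, PowerSeries.coeff n (qExpansion (h : ℝ) Δ₁) = (z : ℂ) := by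
      rw [hΔ₁]
      exact discriminant_qExpansion_natCast_coeff_int hh
    rw [ModularForm.qExpansion_mcast, ModularForm.qExpansion_pow (Nat.cast_pos.mpr
      (Nat.pos_of_ne_zero hh)) hper]
    induction m with
    | zero =>
      intro n
      rw [pow_zero, PowerSeries.coeff_one]
      split_ifs
      · exact ⟨1, by simp⟩
      · exact ⟨0, by simp⟩
    | succ m ih =>
      rw [pow_succ]
      choose a ha using ih
      choose b hb using hΔint
      have hΦ : qExpansion (h : ℝ) Δ₁ ^ m = (PowerSeries.mk a).map (Int.castRingHom ℂ) := by
        ext n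
        rw [PowerSeries.coeff_map, PowerSeries.coeff_mk, ha, eq_intCast]
      have hΨ : qExpansion (h : ℝ) Δ₁ = (PowerSeries.mk b).map (Int.castRingHom ℂ) := by
        ext n
        rw [PowerSeries.coeff_map, PowerSeries.coeff_mk, hb, eq_intCast]
      intro n
      refine ⟨PowerSeries.coeff n (PowerSeries.mk a * PowerSeries.mk b), ?_⟩
      rw [hΦ, hΨ, ← map_mul, PowerSeries.coeff_map, eq_intCast]

/-- **`f(pτ) ∈ R_{Np}`, as a quotient of generators** [cite: CalegariDimitrovTang2025, §4.3, first
paragraph]. Let `u = F/Δᵐ` be a generator of `R_N` (`F` of weight `12m` on a finite-index `G` with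
all conjugates of `Tᴺ`, `F ∈ ℤ⟦q_N⟧`), `p` a prime, `A` with matrix `diag(p, 1)`. Then there are
generators `a = F(pτ)/Δᵐ` (on `A⁻¹ G A ∩ SL₂(ℤ)`) and `b = Δ(pτ)ᵐ/Δᵐ ≠ 0` (on
`A⁻¹ SL₂(ℤ) A ∩ SL₂(ℤ)`) of `R_{Np}` whose quotient is the dilate `u(pτ) = u(A • τ)` pointwise. -/
theorem exists_dilate {N : ℕ} (hN : N ≠ 0) (hp : p.Prime)
    (hA : (A : Matrix (Fin 2) (Fin 2) ℝ) = !![(p : ℝ), 0; 0, 1])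
    {G : Subgroup SL(2, ℤ)} [G.FiniteIndex] (hT : ∀ g : SL(2, ℤ), g * T ^ N * g⁻¹ ∈ G) {m : ℕ}
    (F : ModularForm (G : Subgroup (GL (Fin 2) ℝ)) (12 * (m : ℤ)))
    (hint : ∀ n : ℕ, ∃ z : ℤ, PowerSeries.coeff n (qExpansion (N : ℝ) F) = (z : ℂ)) :
    ∃ (g : ModularForm ((conjGL G A : Subgroup SL(2, ℤ)) : Subgroup (GL (Fin 2) ℝ)) (12 * (m : ℤ)))
      (d : ModularForm ((conjGL ⊤ A : Subgroup SL(2, ℤ)) : Subgroup (GL (Fin 2) ℝ)) (12 * (m : ℤ))),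
      (∀ τ, g τ = F (A • τ)) ∧ (∀ τ, d τ = ModularForm.discriminant (A • τ) ^ m) ∧
      algebraMap hol Mer (modFun m g) ∈ bddDenGens (N * p) ∧
      algebraMap hol Mer (modFun m d) ∈ bddDenGens (N * p) ∧
      algebraMap hol Mer (modFun m d) ≠ 0 ∧
      ∀ τ, (modFun m g : ℍ → ℂ) τ / (modFun m d : ℍ → ℂ) τ = (modFun m F : ℍ → ℂ) (A • τ) := by
  have hNp : N * p ≠ 0 := mul_ne_zero hN hp.ne_zero
  have hN' : 0 < N := Nat.pos_of_ne_zero hN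
  have hTN : T ^ N ∈ G := by simpa using hT 1
  -- the numerator `F(pτ)` (tree: CDT §4.3 ¶1 assembled)
  obtain ⟨hfi, -, hper, g, hg, hgint⟩ :=
    exists_modularForm_conjGL_of_forall_coeff_int F hp hA hN' (mem_strictPeriods_of_T_pow_mem hTN)
      hint
  -- the denominator `Δ(pτ)ᵐ`
  obtain ⟨D, hD, hDint⟩ := exists_discriminant_pow m hN
  obtain ⟨hfi', -, hper', d, hd, hdint⟩ :=
    exists_modularForm_conjGL_of_forall_coeff_int D hp hA hN'
      (mem_strictPeriods_of_T_pow_mem (Subgroup.mem_top _)) hDint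
  haveI := hfi
  haveI := hfi'
  have hd' : ∀ τ, d τ = ModularForm.discriminant (A • τ) ^ m := fun τ ↦ by rw [hd, hD]
  -- all conjugates of `T^{Np}` in the two levels
  have hTg : ∀ x : SL(2, ℤ), x * T ^ (N * p) * x⁻¹ ∈ conjGL G A :=
    conj_T_pow_mul_mem_conjGL_of_forall_conj_T_pow_mem hp hT hA
  have hTd : ∀ x : SL(2, ℤ), x * T ^ (N * p) * x⁻¹ ∈ conjGL (⊤ : Subgroup SL(2, ℤ)) A :=
    conj_T_pow_mul_mem_conjGL_of_forall_conj_T_pow_mem hp (fun _ ↦ Subgroup.mem_top _) hA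
  -- integrality at the period `N p`
  have hgint' : ∀ n : ℕ, ∃ z : ℤ, PowerSeries.coeff n (qExpansion ((N * p : ℕ) : ℝ) g) = (z : ℂ) :=
    fun n ↦ by
      have := forall_coeff_qExpansion_natMul g (h := (N : ℝ)) (Nat.cast_pos.mpr hN') hper
        hp.ne_zero (P := fun x : ℂ ↦ ∃ z : ℤ, x = (z : ℂ)) ⟨0, by simp⟩ hgint n
      simpa only [Nat.cast_mul, mul_comm (p : ℝ)] using this
  have hdint' : ∀ n : ℕ, ∃ z : ℤ, PowerSeries.coeff n (qExpansion ((N * p : ℕ) : ℝ) d) = (z : ℂ) :=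
    fun n ↦ by
      have := forall_coeff_qExpansion_natMul d (h := (N : ℝ)) (Nat.cast_pos.mpr hN') hper'
        hp.ne_zero (P := fun x : ℂ ↦ ∃ z : ℤ, x = (z : ℂ)) ⟨0, by simp⟩ hdint n
      simpa only [Nat.cast_mul, mul_comm (p : ℝ)] using this
  refine ⟨g, d, hg, hd', ⟨conjGL G A, hfi, m, g, hTg, hgint', rfl⟩,
    ⟨conjGL ⊤ A, hfi', m, d, hTd, hdint', rfl⟩, ?_, fun τ ↦ ?_⟩
  · -- `Δ(pτ)ᵐ/Δᵐ ≠ 0`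
    rw [map_ne_zero_iff _ algebraMap_hol_injective]
    intro h0
    have := congrArg (fun f : hol ↦ (f : ℍ → ℂ) UpperHalfPlane.I) h0
    simp only [modFun_apply, hd', Subalgebra.coe_zero, Pi.zero_apply, div_eq_zero_iff,
      pow_eq_zero_iff', ModularForm.discriminant_ne_zero, ne_eq, false_and, or_self] at this
  · simp only [modFun_apply, hg, hd']
    have hΔ : ModularForm.discriminant τ ^ m ≠ 0 := pow_ne_zero _ (ModularForm.discriminant_ne_zero τ)
    have hΔ' : ModularForm.discriminant (A • τ) ^ m ≠ 0 :=
      pow_ne_zero _ (ModularForm.discriminant_ne_zero _)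
    field_simp

/-- **`f(pτ) ∈ R_{Np}`** [cite: CalegariDimitrovTang2025, §4.3, first paragraph]: with notation as in
`exists_dilate`, the dilate `u(pτ)` of a generator `u` of `R_N` — realised in `Mer` as the element
`dilate` of the statement — lies in the field `R_{Np}`, and is the quotient `a/b` of two generators
of `R_{Np}` with `b` fixed by every `x ∈ SL(2, ℤ)` with `p ∣ x₁₀`. -/
theorem exists_dilate_mem_bddDenField {N : ℕ} (hN : N ≠ 0) (hp : p.Prime)
    (hA : (A : Matrix (Fin 2) (Fin 2) ℝ) = !![(p : ℝ), 0; 0, 1])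
    {G : Subgroup SL(2, ℤ)} [G.FiniteIndex] (hT : ∀ g : SL(2, ℤ), g * T ^ N * g⁻¹ ∈ G) {m : ℕ}
    (F : ModularForm (G : Subgroup (GL (Fin 2) ℝ)) (12 * (m : ℤ)))
    (hint : ∀ n : ℕ, ∃ z : ℤ, PowerSeries.coeff n (qExpansion (N : ℝ) F) = (z : ℂ)) :
    ∃ (g : ModularForm ((conjGL G A : Subgroup SL(2, ℤ)) : Subgroup (GL (Fin 2) ℝ)) (12 * (m : ℤ)))
      (b : Mer), (∀ τ, g τ = F (A • τ)) ∧ b ≠ 0 ∧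
      (∀ x : SL(2, ℤ), (p : ℤ) ∣ x 1 0 → x • b = b) ∧
      algebraMap hol Mer (modFun m g) / b ∈ bddDenField (N * p) := by
  obtain ⟨g, d, hg, -, hgmem, hdmem, hd0, -⟩ := exists_dilate hN hp hA hT F hint
  refine ⟨g, algebraMap hol Mer (modFun m d), hg, hd0, fun x hx ↦ ?_, ?_⟩
  · rw [smul_algebraMap, smul_modFun_of_mem d (mem_conjGL_top_of_dvd hA hx)]
  · exact div_mem (IntermediateField.subset_adjoin ℂ _ hgmem)
      (IntermediateField.subset_adjoin ℂ _ hdmem)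

/-! ### §4. Invariance transfer: from the dilate to `F ∣ A` -/

/-- **Invariance transfer.** With `g(τ) = F(A • τ) = F(pτ)` (weight `k = 12m`) and `b ∈ Mer`
non-zero and fixed by a subgroup `H`: if the quotient `(g/Δᵐ)/b` is fixed by `H`, then
`(F ∣ₖ A) ∣ₖ γ = F ∣ₖ A` for every `γ ∈ H` (`F ∣ₖ A = p^{k-1} g`). This converts "`f(pτ)` is invariant
under `⟨E, G ∩ Γ(Np)⟩`" (weight `0`, in `R_{Np}`) into the hypothesis of Theorem 4.3.1.
[cite: CalegariDimitrovTang2025, §4.3 (reduction of Theorem 4.3.2 to Theorem 4.3.1)] -/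
theorem slash_slash_eq_of_smul_div_eq (hA : (A : Matrix (Fin 2) (Fin 2) ℝ) = !![(p : ℝ), 0; 0, 1])
    {G G' : Subgroup SL(2, ℤ)} {m : ℕ} (F : ModularForm (G : Subgroup (GL (Fin 2) ℝ)) (12 * (m : ℤ)))
    (g : ModularForm (G' : Subgroup (GL (Fin 2) ℝ)) (12 * (m : ℤ))) (hg : ∀ τ, g τ = F (A • τ))
    {b : Mer} (hb : b ≠ 0) {H : Subgroup SL(2, ℤ)} (hbH : ∀ γ ∈ H, γ • b = b)
    (hfix : ∀ γ ∈ H, γ • (algebraMap hol Mer (modFun m g) / b) = algebraMap hol Mer (modFun m g) / b)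
    {γ : SL(2, ℤ)} (hγ : γ ∈ H) :
    ((⇑F : ℍ → ℂ) ∣[12 * (m : ℤ)] A) ∣[12 * (m : ℤ)] (mapGL ℝ γ) = (⇑F : ℍ → ℂ) ∣[12 * (m : ℤ)] A := by
  -- `g/Δᵐ` itself is fixed by `H`
  have hfix' : ∀ γ ∈ H, γ • modFun m g = modFun m g := fun γ hγ ↦ by
    apply algebraMap_hol_injective
    have h := hfix γ hγ
    rw [div_eq_mul_inv, smul_mul', smul_inv'', hbH γ hγ, mul_left_inj' (inv_ne_zero hb),
      smul_algebraMap] at h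
    exact h
  have hslash : (⇑g : ℍ → ℂ) ∣[12 * (m : ℤ)] γ = ⇑g := slash_eq_of_forall_smul_modFun_eq g hfix' hγ
  -- `F ∣ A = p^{k-1} • g`
  obtain ⟨-, -, -, -, -, hp⟩ : (A : Matrix (Fin 2) (Fin 2) ℝ) 0 0 = p ∧
      (A : Matrix (Fin 2) (Fin 2) ℝ) 0 1 = 0 ∧ (A : Matrix (Fin 2) (Fin 2) ℝ) 1 0 = 0 ∧
      (A : Matrix (Fin 2) (Fin 2) ℝ) 1 1 = 1 ∧ A.det.val = p ∧ 0 < p := by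
    have hdet : A.det.val = p := by
      rw [Matrix.GeneralLinearGroup.val_det_apply, hA, Matrix.det_fin_two_of]; ring
    refine ⟨by rw [hA]; simp, by rw [hA]; simp, by rw [hA]; simp, by rw [hA]; simp, hdet, ?_⟩
    rcases Nat.eq_zero_or_pos p with h | h
    · exact absurd hdet (by rw [h, Nat.cast_zero]; exact A.det.ne_zero)
    · exact h
  have hFA : (⇑F : ℍ → ℂ) ∣[12 * (m : ℤ)] A = ((p : ℂ) ^ (12 * (m : ℤ) - 1)) • (⇑g : ℍ → ℂ) := by
    ext τ
    rw [slash_diag_apply hA, Pi.smul_apply, smul_eq_mul, hg]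
  rw [hFA]
  change (((p : ℂ) ^ (12 * (m : ℤ) - 1)) • (⇑g : ℍ → ℂ)) ∣[12 * (m : ℤ)] γ = _
  rw [ModularForm.SL_smul_slash, hslash]

/-! ### §5. The dichotomy of Theorem 4.3.2 -/

/-- **Congruence generators of `R_N` are generators of `M_N`**: if `F/Δᵐ ∈ bddDenGens N` with `F`
(the function of) a modular form on SOME congruence subgroup, then `F/Δᵐ ∈ levelGens N` (it is fixed
by its own level-`N`-type group and by a congruence subgroup, hence by `Γ(N)` — Wohlfahrt).
[cite: CalegariDimitrovTang2025, §4.3 (end of the proof of Theorem 4.3.1: "invariant under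
`⟨E, Γ(N)⟩ ∩ Γ₀(p)`, which is to say invariant under a congruence subgroup")] -/
theorem mem_levelGens_of_exists_congruence {N : ℕ} (hN : N ≠ 0) {G : Subgroup SL(2, ℤ)}
    [G.FiniteIndex] (hT : ∀ g : SL(2, ℤ), g * T ^ N * g⁻¹ ∈ G) {m : ℕ}
    (F : ModularForm (G : Subgroup (GL (Fin 2) ℝ)) (12 * (m : ℤ)))
    (hint : ∀ n : ℕ, ∃ z : ℤ, PowerSeries.coeff n (qExpansion (N : ℝ) F) = (z : ℂ))
    (hcong : ∃ (Γ' : Subgroup SL(2, ℤ)) (g : ModularForm (Γ' : Subgroup (GL (Fin 2) ℝ)) (12 * (m : ℤ))),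
      IsCongruenceSubgroup Γ' ∧ (g : ℍ → ℂ) = F) :
    algebraMap hol Mer (modFun m F) ∈ levelGens N := by
  obtain ⟨Γ', g, hΓ', hg⟩ := hcong
  refine mem_levelGens_of_mem_invariantField hN ⟨G, inferInstance, m, F, hT, hint, rfl⟩ ?_
  refine invariantField_inf_le_invariantField_Gamma hT hΓ' (IntermediateField.mem_inf.mpr ⟨?_, ?_⟩)
  · exact algebraMap_modFun_mem_invariantField F
  · rw [← modFun_eq_of_coe_eq m hg]
    exact algebraMap_modFun_mem_invariantField g

/-- ★ **The dichotomy of CDT Theorem 4.3.2** [cite: CalegariDimitrovTang2025, §4.3 (proof of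
Theorem 4.3.2 from Theorem 4.3.1)], generator form. Let `N ≠ 0`, `p ∤ N` prime, `A = diag(p, 1)`;
grant the two inputs of Theorem 4.3.1 at `(N, p)` in hypothesis form — `hker₂` (amalgam
`Γ(N) ⋆ A⁻¹Γ(N)A` + congruence subgroup property of `SL₂(ℤ[1/p])`; Lemma 4.4.1/4.6.2) and `hcor`
(Corollary 4.5.3) — and suppose `R_N` is finitely generated (CDT: `[R_N : M_2] < ∞`). **If
`R_{Np} ⊆ M_{Np} · R_N` then every generator of `R_N` is a generator of `M_N`.** Proof as printed:
`R_N` is fixed by a normal finite-index `G_N ∋ -1` with all conjugates of `Tᴺ` (Lemma 4.2.3); for a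
generator `u = F/Δᵐ`, `u(pτ) ∈ R_{Np} = M_{Np} R_N` is fixed by `G_N ∩ Γ(Np)`, i.e. `F ∣ A` is
(`slash_slash_eq_of_smul_div_eq`); Theorem 4.3.1 (tree:
`exists_congruence_modularForm_of_slash_diag_invariant_of_ker_congruence₂_of_cor453`, applied to `F`
re-bundled on `G_N`) makes `F` congruence; Wohlfahrt makes `u` a generator of `M_N`. -/
theorem bddDenGens_subset_levelGens_of_le_sup {N : ℕ} (hN : N ≠ 0) (hp : p.Prime)
    (hNp : N.Coprime p) (hA : (A : Matrix (Fin 2) (Fin 2) ℝ) = !![(p : ℝ), 0; 0, 1])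
    (hker₂ : ∀ (Δ : Type) [Group Δ] [Finite Δ] (g₁ g₂ : Gamma N →* Δ),
      (∀ (x : SL(2, ℤ)) (hx : x ∈ Gamma N), x ∈ Gamma0 p → ∀ (y : SL(2, ℤ)) (hy : y ∈ Gamma N),
        A * mapGL ℝ x = mapGL ℝ y * A → g₁ ⟨x, hx⟩ = g₂ ⟨y, hy⟩) →
      (∃ M : ℕ, M ≠ 0 ∧ ∀ (x : SL(2, ℤ)) (hx : x ∈ Gamma N), x ∈ Gamma M → g₁ ⟨x, hx⟩ = 1) ∧
      (∃ M : ℕ, M ≠ 0 ∧ ∀ (x : SL(2, ℤ)) (hx : x ∈ Gamma N), x ∈ Gamma M → g₂ ⟨x, hx⟩ = 1))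
    (hcor : ∀ (Q : Type) [CommGroup Q] [Finite Q] (θ : Gamma N →* Q),
      (∀ g : SL(2, ℤ), ∃ M : ℕ, M ≠ 0 ∧ ∀ (x : SL(2, ℤ)) (hx : x ∈ Gamma N)
        (hgx : g * x * g⁻¹ ∈ Gamma N), x ∈ Gamma M → θ ⟨g * x * g⁻¹, hgx⟩ = θ ⟨x, hx⟩) →
      ∃ M : ℕ, M ≠ 0 ∧ ∀ (x : SL(2, ℤ)) (hx : x ∈ Gamma N), x ∈ Gamma M → θ ⟨x, hx⟩ = 1)
    (hfg : (bddDenField N).FG)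
    (hE : bddDenField (N * p) ≤ levelField (N * p) ⊔ bddDenField N) :
    bddDenGens N ⊆ levelGens N := by
  have hNp0 : N * p ≠ 0 := mul_ne_zero hN hp.ne_zero
  -- Lemma 4.2.3: a common level group fixing `R_N`
  obtain ⟨GN, hGNfi, hGNn, -, -, hGNT, -, hGNle⟩ :=
    exists_commonLevel_bddDenField_le_invariantField hN hfg
  haveI := hGNfi
  haveI := hGNn
  -- `M_{Np} R_N` is fixed by `G_N ∩ Γ(Np)`
  have hfixE : levelField (N * p) ⊔ bddDenField N ≤ invariantField (GN ⊓ Gamma (N * p)) :=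
    sup_le ((levelField_le_invariantField (N * p)).trans (invariantField_anti inf_le_right))
      (hGNle.trans (invariantField_anti inf_le_left))
  rintro u ⟨G, hG, m, F, hT, hint, rfl⟩
  -- re-bundle `F` on `G_N`
  have hFfix : ∀ γ ∈ GN, γ • modFun m F = modFun m F := fun γ hγ ↦
    algebraMap_hol_injective (by
      rw [← smul_algebraMap]
      exact mem_invariantField_iff.mp
        (hGNle (algebraMap_modFun_mem_bddDenField hT F hint)) γ hγ)
  obtain ⟨F', hF'⟩ := exists_modularForm_of_forall_smul_modFun_eq F hFfix
  -- the dilate `u(pτ) = a/b ∈ R_{Np} ⊆ M_{Np} R_N` is fixed by `G_N ∩ Γ(Np)`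
  obtain ⟨g, b, hg, hb, hbfix, hmem⟩ := exists_dilate_mem_bddDenField hN hp hA hT F hint
  have hfix : ∀ γ ∈ GN ⊓ Gamma (N * p), γ • (algebraMap hol Mer (modFun m g) / b) =
      algebraMap hol Mer (modFun m g) / b := fun γ hγ ↦
    mem_invariantField_iff.mp (hfixE (hE hmem)) γ hγ
  have hbH : ∀ γ ∈ GN ⊓ Gamma (N * p), γ • b = b := fun γ hγ ↦
    hbfix γ ((Int.natCast_dvd_natCast.mpr (dvd_mul_left p N)).trans
      ((ZMod.intCast_zmod_eq_zero_iff_dvd _ (N * p)).mp (Gamma_mem.mp hγ.2).2.2.1))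
  -- Theorem 4.3.1 for `F'` on the normal group `G_N`
  have hinv : ∀ γ ∈ GN ⊓ Gamma (N * p),
      ((⇑F' : ℍ → ℂ) ∣[12 * (m : ℤ)] A) ∣[12 * (m : ℤ)] (mapGL ℝ γ) = (⇑F' : ℍ → ℂ) ∣[12 * (m : ℤ)] A := by
    intro γ hγ
    rw [hF']
    exact slash_slash_eq_of_smul_div_eq hA F g hg hb hbH hfix hγ
  have hcong := exists_congruence_modularForm_of_slash_diag_invariant_of_ker_congruence₂_of_cor453
    hGNT hN hp hNp hA hker₂ hcor F' hinv
  rw [hF'] at hcong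
  exact mem_levelGens_of_exists_congruence hN hT F hint hcong

/-- ★ **The dichotomy of CDT Theorem 4.3.2, field form** [cite: CalegariDimitrovTang2025, §4.3
(Theorem 4.3.2)]: under the inputs of Theorem 4.3.1 at `(N, p)` and finite generation of `R_N`,
**`R_{Np} ⊆ M_{Np} · R_N` implies `R_N = M_N`** — CDT's "`[R_{Np} : R_N M_{Np}]` … is either `≥ 2`,
in which case we have proven Theorem 4.3.2, or `R_{Np} = R_N M_{Np}` [which forces, by Theorem
4.3.1, every form of `R_N` to be congruence]", here without the degree count. -/
theorem bddDenField_eq_levelField_of_le_sup {N : ℕ} (hN : N ≠ 0) (hp : p.Prime)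
    (hNp : N.Coprime p) (hA : (A : Matrix (Fin 2) (Fin 2) ℝ) = !![(p : ℝ), 0; 0, 1])
    (hker₂ : ∀ (Δ : Type) [Group Δ] [Finite Δ] (g₁ g₂ : Gamma N →* Δ),
      (∀ (x : SL(2, ℤ)) (hx : x ∈ Gamma N), x ∈ Gamma0 p → ∀ (y : SL(2, ℤ)) (hy : y ∈ Gamma N),
        A * mapGL ℝ x = mapGL ℝ y * A → g₁ ⟨x, hx⟩ = g₂ ⟨y, hy⟩) →
      (∃ M : ℕ, M ≠ 0 ∧ ∀ (x : SL(2, ℤ)) (hx : x ∈ Gamma N), x ∈ Gamma M → g₁ ⟨x, hx⟩ = 1) ∧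
      (∃ M : ℕ, M ≠ 0 ∧ ∀ (x : SL(2, ℤ)) (hx : x ∈ Gamma N), x ∈ Gamma M → g₂ ⟨x, hx⟩ = 1))
    (hcor : ∀ (Q : Type) [CommGroup Q] [Finite Q] (θ : Gamma N →* Q),
      (∀ g : SL(2, ℤ), ∃ M : ℕ, M ≠ 0 ∧ ∀ (x : SL(2, ℤ)) (hx : x ∈ Gamma N)
        (hgx : g * x * g⁻¹ ∈ Gamma N), x ∈ Gamma M → θ ⟨g * x * g⁻¹, hgx⟩ = θ ⟨x, hx⟩) →
      ∃ M : ℕ, M ≠ 0 ∧ ∀ (x : SL(2, ℤ)) (hx : x ∈ Gamma N), x ∈ Gamma M → θ ⟨x, hx⟩ = 1)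
    (hfg : (bddDenField N).FG)
    (hE : bddDenField (N * p) ≤ levelField (N * p) ⊔ bddDenField N) :
    bddDenField N = levelField N :=
  le_antisymm
    (IntermediateField.adjoin_le_iff.mpr fun _ hu ↦ IntermediateField.subset_adjoin ℂ _
      (bddDenGens_subset_levelGens_of_le_sup hN hp hNp hA hker₂ hcor hfg hE hu))
    (levelField_le_bddDenField N)

end UnboundedDenominators

end Literature.NumberTheory.Automorphic

end
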